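import Summits.QuantumFields.YangMills.Theorems.BalabanUVNodesN06Row17LocalClauseAtFlatCubeDom
import Literature.MathematicalPhysics.QuantumFieldTheory.Balaban1983to89.B9DeltaALocalGaugeCovY
import Literature.MathematicalPhysics.QuantumFieldTheory.Balaban1983to89.B9Thm311DeltaAGaugeOrbit

/-!
# BalabanUVNodes ∕ N06 ([B9], `Dag.B9_main`) — ROW 17's LOCAL CLAUSE ON THE PURE-GAUGE ORBIT: the positivity of the padded local bond operator
# `Δ_{a,□}(U)` (node00-def-Y FILE 40) is a property of the GAUGE ORBIT of `U`, hence holds at every pure gauge `U = 1^u` — print's step (ii) of the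
# p. 416 road to Cor. 3.6, composed with this seat's «G_□(1) ≥ 0»

Track A of `YM-PLAN.md` (cell `pub-ymgap`, HUMAN RULING D-0062), node **N06** = [Balaban1985BackgroundPropagators] Thms 3.1–3.15; seat `pub-ymgap-dag-n06-j`
(bundle F5, rows 15–17), g22, FILE 4b.  A HELPER (count-neutral, `--supports` only).

THE PRINT.  [B9] p. 416: *«Let us consider G_□(U) and let us make a gauge transformation to the gauge in which U = e^{iηA}, A small … by (3.86) we get
G_□(e^{iηA}) = G_□(1)(I − V(A)G_□(1))⁻¹. In [4] we have proved that the operator G_□(1) is positive …»*; (3.34) p. 396: *«Δ_a(U^u) = R(u)Δ_a(U)R(u⁻¹),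
G(U^u) = R(u)G(U)R(u⁻¹)»*.

WHAT.  With `B9DeltaALocalGaugeCovY.padDeltaALocY_cov` (this seat, FILE 4a: `Δ_{a,□}`'s padded compression intertwines the gauge action) and g10's
`B9Thm311DeltaAGaugeOrbit.posDefTr_iff_of_intw_conjY` (the trace pairing is `R(u)`-invariant for unitary `u`):
* ★★ `posDefTr_padDeltaALocY_gaugeY_iff` — `PosDefTr 1 (padDeltaALocY … (U^u)) ↔ PosDefTr 1 (padDeltaALocY … U)` at def-Y's lawful transporters
  `parSymY ∕ parBY`, for every unitary-valued gauge function `u` and every `U`: the `hloc` input of `…N06Row19LocalClauseAtDirichletInverses.hGsqA_of_GAsqY_pins`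
  is CONSTANT ON GAUGE ORBITS (print's step (ii));
* ★★★ `posDefTr_padDeltaALocY_pureGauge` — `hloc` HOLDS AT EVERY PURE GAUGE `U = 1^u` (FILE 2's `posDefTr_padDeltaALocY_one` transported along the orbit),
  `…_pureGauge_cubeDomY` (at W-a's `D := cubeDomY x c`), `isUnit_padDeltaALocY_pureGauge`;
* ★ `localClause_GAsqY_pureGauge` — both conjuncts of `hGsqA` for the scaled coordinate model of `G_□(1^u) = GAsqY … (1^u)`, any `c ≥ 0`;
* §3 ★★★ `posDefTr_padDeltaALocY_of_cubeGauge_smallness` — THE ROAD ASSEMBLED: (i) + (ii) + the sqrt-free engine `posDefTr_of_mul_eq_one_sub_of_le` give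
  `PosDefTr 1 (padDeltaALocY … U)` from the ONE displayed input (iii) `⟨A, (T(1) − T(U^u))T(1)⁻¹A⟩₁ ≤ θ⟨A, A⟩₁`, `θ < 1` (`u` any `G`-valued gauge function).
So of print's three inputs for `hloc` on (3.35) only (iii) — the Sect.-B numerical-radius smallness of `V(A)G_□(1)` in the cube gauge — remains.
HONEST FRAMING.  Linear algebra (covariance + trace-pairing invariance) over FILES 2∕4a; Cor. 3.6 on (3.35) NOT proved; nothing of [B9]'s estimates; COUNT-NEUTRAL;
N06 NOT discharged; nothing continuum ∕ OS ∕ mass gap ∕ Clay.  0 `def`, 0 `sorry`.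
-/

noncomputable section

namespace Summit.QuantumFields.YangMills.BalabanUVNodes.N06Row17LocalClauseAtPureGauge

open Literature.MathematicalPhysics.QuantumFieldTheory.Balaban1983to89
open Literature.MathematicalPhysics.QuantumFieldTheory.Balaban1983to89.Node00
open Literature.MathematicalPhysics.QuantumFieldTheory.Balaban1983to89.Node00.OpsYLocalInverse (dirPadY dirInvY)
open Literature.MathematicalPhysics.QuantumFieldTheory.Balaban1983to89.Node00.OpsYDeltaALocal (deltaALocY padDeltaALocY GAsqY)
open Literature.MathematicalPhysics.QuantumFieldTheory.Balaban1983to89.B9Thm311ReadingCoords (PosDefTr IsSymmTr isUnit_of_posDefTr)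
open Literature.MathematicalPhysics.QuantumFieldTheory.Balaban1983to89.B9Thm37CubeCoverCommutators (cutMulY)
open Literature.MathematicalPhysics.QuantumFieldTheory.Balaban1983to89.B9CoReadingCoords (coordOpK)
open Literature.MathematicalPhysics.QuantumFieldTheory.Balaban1983to89.B9CoReadingCoordsTranspose (TrIdx trBasis)
open Literature.MathematicalPhysics.QuantumFieldTheory.Balaban1983to89.B9Thm37Glue (IsTransposePair)
open Literature.MathematicalPhysics.QuantumFieldTheory.Balaban1983to89.B9Thm311DeltaAGaugeOrbit (posDefTr_iff_of_intw_conjY gBondY_mem_unitary)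
open Literature.MathematicalPhysics.QuantumFieldTheory.Balaban1983to89.B9Thm311CoercivePureGaugeAtLettersY (gaugeY_one_mem)
open Literature.MathematicalPhysics.QuantumFieldTheory.Balaban1983to89.B9DeltaALocalGaugeCovY (padDeltaALocY_cov)
open Literature.MathematicalPhysics.QuantumFieldTheory.Balaban1983to89.B6KLevelCensusIndexV1 (KIdx)
open Literature.MathematicalPhysics.QuantumFieldTheory.Balaban1983to89.B6Geom246MultiLevelBox (blkOf)
open Literature.MathematicalPhysics.QuantumFieldTheory.Balaban1983to89.B6Cover236MultiLevelBlocks (cubes)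
open Literature.MathematicalPhysics.QuantumFieldTheory.Balaban1983to89.B9PinMembersKLevelV1 (MemberY)
open Literature.MathematicalPhysics.QuantumFieldTheory.Balaban1983to89.B9WalkLettersCoordsS (cubeDomY)
open OpsYNablaBridge (chartY)
open Summit.QuantumFields.YangMills.BalabanUVNodes.N06Row19LocalClauseAtDirichletInverses (localClause_coordOpK_dirInvY isSymmTr_deltaALocY_parSymY)
open Summit.QuantumFields.YangMills.BalabanUVNodes.N06Row17LocalClauseAtFlat (posDefTr_padDeltaALocY_one)
open Summit.QuantumFields.YangMills.BalabanUVNodes.N06Row17LocalClauseAtFlatCubeDom (blocks_of_cut_sub_cubeDomY)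
open scoped Matrix
open scoped Matrix.Norms.L2Operator

variable {N : ℕ} {d ℓ : ℕ} {hd : 1 ≤ d + 1} {hL : Odd (ℓ + 1) ∧ 1 < ℓ + 1} {b₀ b₁ : ℝ} (i : KIdx d ℓ hd hL b₀ b₁)

/-- ★★ **THE POSITIVITY OF THE PADDED LOCAL BOND OPERATOR IS A PROPERTY OF THE GAUGE ORBIT** (print's step (ii), p. 416): for def-Y's lawful transporters
`parSymY ∕ parBY`, real block ∕ bond cut-offs, every unitary-valued gauge function `u` and every configuration `U`,
`PosDefTr 1 (padDeltaALocY … (U^u)) ↔ PosDefTr 1 (padDeltaALocY … U)` — (3.34) for the local letters (`padDeltaALocY_cov`) and the `R(u)`-invariance of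
the trace pairing. [cite: Balaban1985BackgroundPropagators, Thm 3.11 proof p.416 («let us make a gauge transformation to the gauge in which U = e^{iηA}»), (3.34) p.396] -/
theorem posDefTr_padDeltaALocY_gaugeY_iff {u : GaugeY (Matrix (Fin N) (Fin N) ℂ) i}
    (hu : ∀ x, ((u x : (Matrix (Fin N) (Fin N) ℂ)ˣ) : Matrix (Fin N) (Fin N) ℂ) ∈ unitary _) (D : Finset (SiteY i)) (χP : BlkY i → ℝ)
    (χ : FBondY i → ℝ) (U : CfgY (Matrix (Fin N) (Fin N) ℂ) i) :
    PosDefTr (fun _ => (1 : ℝ)) (padDeltaALocY i (parSymY i) (parBY i) D (cutMulY χP) (cutMulY χ) (gaugeY i u U))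
      ↔ PosDefTr (fun _ => (1 : ℝ)) (padDeltaALocY i (parSymY i) (parBY i) D (cutMulY χP) (cutMulY χ) U) :=
  (posDefTr_iff_of_intw_conjY (gBondY_mem_unitary i hu)
    (padDeltaALocY_cov (g := u) (U := U) (parSymY_isGaugeLawS i) (parBY_isGaugeLawB i) D χP χ)).symm

/-- ★★★ **`hloc` AT EVERY PURE GAUGE `U = 1^u`** (`u` unitary-valued): the padded local bond operator `M_χΔ_{a,□}(1^u)M_χ + (1 − M_χ)` is positive definite —
FILE 2's «G_□(1) ≥ 0» (`posDefTr_padDeltaALocY_one`) transported along the gauge orbit of the trivial configuration; 0∕1-valued cuts `χP`, `χ` with every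
block of `𝔅` containing a `χ`-bond inside `D`. [cite: Balaban1985BackgroundPropagators, Thm 3.11 proof p.416, (3.34) p.396, Cor. 3.5 p.407; Balaban1984PropagatorsII, p.226] -/
theorem posDefTr_padDeltaALocY_pureGauge {u : GaugeY (Matrix (Fin N) (Fin N) ℂ) i}
    (hu : ∀ x, ((u x : (Matrix (Fin N) (Fin N) ℂ)ˣ) : Matrix (Fin N) (Fin N) ℂ) ∈ unitary _) (D : Finset (SiteY i)) {χP : BlkY i → ℝ}
    (hχP : ∀ y, χP y = 0 ∨ χP y = 1) {χ : FBondY i → ℝ} (hχ : ∀ b, χ b = 0 ∨ χ b = 1)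
    (hD : ∀ z : SiteY i, z ∉ D → ∀ b : FBondY i, blkOf i.D.toDomains (chartY i b.src) = blkOf i.D.toDomains z →
      blkOf i.D.toDomains (chartY i b.tgt) = blkOf i.D.toDomains z → χ b = 0) :
    PosDefTr (fun _ => (1 : ℝ))
      (padDeltaALocY i (parSymY i) (parBY i) D (cutMulY χP) (cutMulY χ) (gaugeY i u (fun _ _ => 1))) :=
  (posDefTr_padDeltaALocY_gaugeY_iff i hu D χP χ _).mpr (posDefTr_padDeltaALocY_one i D hχP hχ hD)

/-- hence the padded `Δ_{a,□}(1^u)` is a unit: `G_□(1^u) = GAsqY … (1^u)` is its genuine inverse on the cut-off's bonds.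
[cite: Balaban1985BackgroundPropagators, pp.408–409 (G_□), (3.34) p.396] -/
theorem isUnit_padDeltaALocY_pureGauge {u : GaugeY (Matrix (Fin N) (Fin N) ℂ) i}
    (hu : ∀ x, ((u x : (Matrix (Fin N) (Fin N) ℂ)ˣ) : Matrix (Fin N) (Fin N) ℂ) ∈ unitary _) (D : Finset (SiteY i)) {χP : BlkY i → ℝ}
    (hχP : ∀ y, χP y = 0 ∨ χP y = 1) {χ : FBondY i → ℝ} (hχ : ∀ b, χ b = 0 ∨ χ b = 1)
    (hD : ∀ z : SiteY i, z ∉ D → ∀ b : FBondY i, blkOf i.D.toDomains (chartY i b.src) = blkOf i.D.toDomains z →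
      blkOf i.D.toDomains (chartY i b.tgt) = blkOf i.D.toDomains z → χ b = 0) :
    IsUnit (padDeltaALocY i (parSymY i) (parBY i) D (cutMulY χP) (cutMulY χ) (gaugeY i u (fun _ _ => 1))) :=
  isUnit_of_posDefTr (posDefTr_padDeltaALocY_pureGauge i hu D hχP hχ hD)

variable {Mstar : ℕ} in
/-- ★★★ the same at W-a's cube data `D := cubeDomY x c` (a union of blocks; `χ`-bonds starting in □̃).
[cite: Balaban1985BackgroundPropagators, Thm 3.11 proof p.416, (3.34) p.396, pp.408–409] -/
theorem posDefTr_padDeltaALocY_pureGauge_cubeDomY (x : MemberY d ℓ hd hL b₀ b₁ Mstar) {u : GaugeY (Matrix (Fin N) (Fin N) ℂ) x.toKIdx}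
    (hu : ∀ y, ((u y : (Matrix (Fin N) (Fin N) ℂ)ˣ) : Matrix (Fin N) (Fin N) ℂ) ∈ unitary _) (c : ↥(cubes x.toKIdx.D.toDomains))
    {χP : BlkY x.toKIdx → ℝ} (hχP : ∀ y, χP y = 0 ∨ χP y = 1) {χ : FBondY x.toKIdx → ℝ} (hχ : ∀ b, χ b = 0 ∨ χ b = 1)
    (hχD : ∀ b : FBondY x.toKIdx, χ b ≠ 0 → chartY x.toKIdx b.src ∈ cubeDomY x c) :
    PosDefTr (fun _ => (1 : ℝ))
      (padDeltaALocY x.toKIdx (parSymY x.toKIdx) (parBY x.toKIdx) (cubeDomY x c) (cutMulY χP) (cutMulY χ) (gaugeY x.toKIdx u (fun _ _ => 1))) :=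
  posDefTr_padDeltaALocY_pureGauge x.toKIdx hu (cubeDomY x c) hχP hχ (blocks_of_cut_sub_cubeDomY x c hχD)

/-- ★ **ROW 17's LOCAL CLAUSE INHABITED ON THE WHOLE PURE-GAUGE ORBIT**: both conjuncts of `hGsqA` — self-transpose and positive semi-definite — for the
scaled coordinate model of `G_□(1^u) = GAsqY … (1^u)`, any unitary-valued `u` with values in a subgroup `G ≤ U(N)` (so that `1^u` is `G`-valued), any
`c ≥ 0`. [cite: Balaban1985BackgroundPropagators, Thm 3.11 p.416 («positivity of the operators G_□»), (3.34) p.396, Cor. 3.5 p.407] -/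
theorem localClause_GAsqY_pureGauge {G : Subgroup (Matrix (Fin N) (Fin N) ℂ)ˣ} (hG : G ≤ B7Prop2Explicit.unitaryUnits (Matrix (Fin N) (Fin N) ℂ))
    {u : GaugeY (Matrix (Fin N) (Fin N) ℂ) i} (huG : ∀ x, u x ∈ G) {Dd : Type} [Fintype Dd] (D : Finset (SiteY i)) {χP : BlkY i → ℝ}
    (hχP : ∀ y, χP y = 0 ∨ χP y = 1) {χ : FBondY i → ℝ} (hχ : ∀ b, χ b = 0 ∨ χ b = 1)
    (hD : ∀ z : SiteY i, z ∉ D → ∀ b : FBondY i, blkOf i.D.toDomains (chartY i b.src) = blkOf i.D.toDomains z →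
      blkOf i.D.toDomains (chartY i b.tgt) = blkOf i.D.toDomains z → χ b = 0) {c : ℝ} (hc : 0 ≤ c) :
    IsTransposePair
        (c • coordOpK (trBasis N) (fun _ : Dd =>
          (GAsqY i (parSymY i) (parBY i) D (cutMulY χP) (cutMulY χ) (gaugeY i u (fun _ _ => 1))).restrictScalars ℝ))
        (c • coordOpK (trBasis N) (fun _ : Dd =>
          (GAsqY i (parSymY i) (parBY i) D (cutMulY χP) (cutMulY χ) (gaugeY i u (fun _ _ => 1))).restrictScalars ℝ)) ∧
      ∀ v : FBondY i × Dd × TrIdx N × TrIdx N → ℝ,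
        0 ≤ v ⬝ᵥ (c • coordOpK (trBasis N) (fun _ : Dd =>
          (GAsqY i (parSymY i) (parBY i) D (cutMulY χP) (cutMulY χ) (gaugeY i u (fun _ _ => 1))).restrictScalars ℝ)) v :=
  localClause_coordOpK_dirInvY (D := Dd) χ
    (isSymmTr_deltaALocY_parSymY i hG (gaugeY_one_mem i huG) D χP)
    (posDefTr_padDeltaALocY_pureGauge i (fun x => hG (huG x)) D hχP hχ hD) hc

/-! ## §3 ★★★ The p. 416 road assembled: `hloc(U)` from the ONE remaining input — the cube-gauge smallness (iii) -/

open Literature.MathematicalPhysics.QuantumFieldTheory.Balaban1983to89.B9Thm311ReadingCoords (trIP)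
open Literature.MathematicalPhysics.QuantumFieldTheory.Balaban1983to89.B9Thm311DeltaPrimePos (posDefTr_ringInverse)
open Literature.MathematicalPhysics.QuantumFieldTheory.Balaban1983to89.B9Thm311PosViaLocalInversesY (posDefTr_of_mul_eq_one_sub_of_le)
open Summit.QuantumFields.YangMills.BalabanUVNodes.N06Row19LocalClauseAtDirichletInverses (isSymmTr_dirPadY_cutMulY)

/-- a gauge transform of a `G`-valued configuration by a `G`-valued gauge function is `G`-valued. [cite: Balaban1985BackgroundPropagators, (3.28) p.395, (3.35) p.396 (gauge-invariant class)] -/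
theorem gaugeY_mem_of_mem {G : Subgroup (Matrix (Fin N) (Fin N) ℂ)ˣ} {u : GaugeY (Matrix (Fin N) (Fin N) ℂ) i} (huG : ∀ x, u x ∈ G)
    {U : CfgY (Matrix (Fin N) (Fin N) ℂ) i} (hU : ∀ μ x, U μ x ∈ G) (μ : Fin (d + 1)) (x : Site (B6GlobalChartV1.PV d ℓ i.m i.K hd hL) 0) :
    gaugeY i u U μ x ∈ G := by
  rw [gaugeY_apply]
  exact G.mul_mem (G.mul_mem (huG x) (hU μ x)) (G.inv_mem (huG _))

/-- ★★★ **PRINT's p. 416 ROAD FOR THE LOCAL PROPAGATORS, ASSEMBLED AT node00-def-Y's LETTERS**: let `T(W) := M_χΔ_{a,□}(W)M_χ + (1 − M_χ)` be the padded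
local bond operator (site set `D`, 0∕1 cuts `χP`, `χ` with □'s blocks inside `D`), `G`-valued `U` (`G ≤ U(N)`), and `u` a `G`-valued gauge function (print:
the cube axial gauge, `U^u = e^{iηA}`, `A` small).  (i) `T(1) > 0` (FILE 2) and `G₀ := T(1)⁻¹ > 0`; (ii) `T(U) > 0 ⟺ T(U^u) > 0` (§1); so if (iii) the
NUMERICAL-RADIUS SMALLNESS `⟨A, (T(1) − T(U^u))·G₀·A⟩₁ ≤ θ⟨A, A⟩₁`, `θ < 1` (*«V(A)G_□(1)» small*, Sect. B in the cube gauge) holds, then `T(U^u)·G₀ = 1 − R`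
with `R = (T(1) − T(U^u))G₀` and the sqrt-free engine `posDefTr_of_mul_eq_one_sub_of_le` gives `T(U^u) > 0`, hence **`PosDefTr 1 (padDeltaALocY … U)`** — the
`hloc` of `hGsqA_of_GAsqY_pins` at this `U`, with EXACTLY print's (iii) displayed. [cite: Balaban1985BackgroundPropagators, Thm 3.11 proof p.416 («G_□(e^{iηA}) = G_□(1)(I − V(A)G_□(1))⁻¹ … by the same reasoning as above»), (3.86) p.408, Cor. 3.6 p.408, (3.34) p.396] -/
theorem posDefTr_padDeltaALocY_of_cubeGauge_smallness {G : Subgroup (Matrix (Fin N) (Fin N) ℂ)ˣ}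
    (hG : G ≤ B7Prop2Explicit.unitaryUnits (Matrix (Fin N) (Fin N) ℂ)) {U : CfgY (Matrix (Fin N) (Fin N) ℂ) i} (hU : ∀ μ x, U μ x ∈ G)
    {u : GaugeY (Matrix (Fin N) (Fin N) ℂ) i} (huG : ∀ x, u x ∈ G) (D : Finset (SiteY i)) {χP : BlkY i → ℝ} (hχP : ∀ y, χP y = 0 ∨ χP y = 1)
    {χ : FBondY i → ℝ} (hχ : ∀ b, χ b = 0 ∨ χ b = 1)
    (hD : ∀ z : SiteY i, z ∉ D → ∀ b : FBondY i, blkOf i.D.toDomains (chartY i b.src) = blkOf i.D.toDomains z →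
      blkOf i.D.toDomains (chartY i b.tgt) = blkOf i.D.toDomains z → χ b = 0) {θ : ℝ} (hθ : θ < 1)
    (hsmall : ∀ A : FBondY i → Matrix (Fin N) (Fin N) ℂ,
      trIP (fun _ => (1 : ℝ)) A
        (((padDeltaALocY i (parSymY i) (parBY i) D (cutMulY χP) (cutMulY χ) (fun _ _ => 1 : CfgY (Matrix (Fin N) (Fin N) ℂ) i)
            - padDeltaALocY i (parSymY i) (parBY i) D (cutMulY χP) (cutMulY χ) (gaugeY i u U))
          * Ring.inverse (padDeltaALocY i (parSymY i) (parBY i) D (cutMulY χP) (cutMulY χ) (fun _ _ => 1 : CfgY (Matrix (Fin N) (Fin N) ℂ) i))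
            : Module.End ℂ (FBondY i → Matrix (Fin N) (Fin N) ℂ)) A)
        ≤ θ * trIP (fun _ => (1 : ℝ)) A A) :
    PosDefTr (fun _ => (1 : ℝ)) (padDeltaALocY i (parSymY i) (parBY i) D (cutMulY χP) (cutMulY χ) U) := by
  have hPD1 := posDefTr_padDeltaALocY_one (N := N) i D hχP hχ hD
  have hunit := isUnit_of_posDefTr hPD1
  have hfac : padDeltaALocY i (parSymY i) (parBY i) D (cutMulY χP) (cutMulY χ) (gaugeY i u U)
        * Ring.inverse (padDeltaALocY i (parSymY i) (parBY i) D (cutMulY χP) (cutMulY χ) (fun _ _ => 1 : CfgY (Matrix (Fin N) (Fin N) ℂ) i))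
      = 1 - (padDeltaALocY i (parSymY i) (parBY i) D (cutMulY χP) (cutMulY χ) (fun _ _ => 1 : CfgY (Matrix (Fin N) (Fin N) ℂ) i)
            - padDeltaALocY i (parSymY i) (parBY i) D (cutMulY χP) (cutMulY χ) (gaugeY i u U))
          * Ring.inverse (padDeltaALocY i (parSymY i) (parBY i) D (cutMulY χP) (cutMulY χ) (fun _ _ => 1 : CfgY (Matrix (Fin N) (Fin N) ℂ) i)) := by
    rw [sub_mul, Ring.mul_inverse_cancel _ hunit, sub_sub_cancel]
  have hsymm : IsSymmTr (fun _ => (1 : ℝ)) (padDeltaALocY i (parSymY i) (parBY i) D (cutMulY χP) (cutMulY χ) (gaugeY i u U)) :=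
    isSymmTr_dirPadY_cutMulY χ (isSymmTr_deltaALocY_parSymY i hG (gaugeY_mem_of_mem i huG hU) D χP)
  have hV := posDefTr_of_mul_eq_one_sub_of_le (fun _ => one_pos) hsymm (posDefTr_ringInverse hPD1) hfac hθ hsmall
  exact (posDefTr_padDeltaALocY_gaugeY_iff i (fun x => hG (huG x)) D χP χ U).mp hV

end Summit.QuantumFields.YangMills.BalabanUVNodes.N06Row17LocalClauseAtPureGauge

end
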